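import Literature.Analysis.DeBrangesSpaces.BurnolCosineKernelEntire
import Literature.Analysis.Complex.HolomorphicParametricIntegral
import HarnessLib

/-!
# Burnol 2001 (CRAS 333), §1: scaling structure of the kernel `C_a(u,w)` in `u`

`C_a(u,w) = 2∫_a^∞ cos(2πut) t^{w−1} dt` (TeX l.338) satisfies, by the substitution `s = ut`,

  `C_a(u,w) = u^{−w} · C_{ua}(1,w)`                                  (`cosKernel_scaling`),
  `C_b(1,w) − C_{b'}(1,w) = 2∫_b^{b'} cos(2πs) s^{w−1} ds`, `0 < b ≤ b'`   (`cosKernel_sub_cosKernel`),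

first for `Re w < 0` from the integrals, then for every `w` by analytic continuation (both sides are
entire in `w`; the finite integral is entire by dominated differentiation).  Hence
`C_λ(t,w) = t^{−w}(C_λ(1,w) ± 2∫ cos(2πs)s^{w−1}ds)` over the segment between `λt` and `λ`: the
dependence on `t` is `t^{−w}` times an analytic function of `t` on `(0,∞)` — the structure behind
"par analyticité" and the singular parts `(log 1/t)^k t^{−w}` in Burnol's proof of Théorème 1.5
(TeX l.409–416), valid for every `w` (brick 3a of the proof of `Burnol2001CRAS_thm1_5C`).  RH-FREE.

## References
* [Burnol2001CRAS] J.-F. Burnol, C. R. Acad. Sci. Paris 333 (2001) 201–206, §1, Lemme 1.2,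
  eq. (1.3), proof of Thm. 1.5 (TeX l.338–355, 409–416).
-/

open MeasureTheory Set Filter Complex Metric
open scoped Real Topology

namespace Literature.Analysis.DeBrangesSpaces

namespace SonineMellin

/-- `t^{z} = (ut)^{z} · u^{−z}`-bookkeeping: `((u t : ℝ) : ℂ)^z = (u : ℂ)^z (t : ℂ)^z` for `u, t ≥ 0`.
[folklore] -/
private theorem cpow_mul_ofReal {u t : ℝ} (hu : 0 ≤ u) (ht : 0 ≤ t) (z : ℂ) :
    (((u * t : ℝ)) : ℂ) ^ z = (u : ℂ) ^ z * (t : ℂ) ^ z := by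
  rw [Complex.ofReal_mul, Complex.mul_cpow_ofReal_nonneg hu ht]

/-- **Scaling of Burnol's integral**: `C_a(u,w) = u^{−w} C_{ua}(1,w)` (`a, u > 0`; substitution
`s = ut`; an identity of Bochner integrals, meaningful for `Re w < 0`). [cite: Burnol2001CRAS, §1 (TeX l.338)] -/
theorem burnolC_scaling {a u : ℝ} (ha : 0 < a) (hu : 0 < u) (w : ℂ) :
    Burnol2001.burnolC a u w = (u : ℂ) ^ (-w) * Burnol2001.burnolC (u * a) 1 w := by
  have hu0 : (u : ℂ) ≠ 0 := Complex.ofReal_ne_zero.2 hu.ne'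
  rw [Burnol2001.burnolC, Burnol2001.burnolC]
  -- `∫_a^∞ cos(2πut) t^{w−1} dt = u^{1−w} ∫_a^∞ g(ut) dt`, `g(s) = cos(2πs) s^{w−1}`
  set g : ℝ → ℂ := fun s ↦ (Real.cos (2 * π * 1 * s) : ℂ) * (s : ℂ) ^ (w - 1) with hg
  have h1 : ∫ t in Ioi a, (Real.cos (2 * π * u * t) : ℂ) * (t : ℂ) ^ (w - 1) =
      (u : ℂ) ^ (-(w - 1)) * ∫ t in Ioi a, g (u * t) := by
    rw [← integral_const_mul]
    refine setIntegral_congr_fun measurableSet_Ioi (fun t ht ↦ ?_)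
    have ht0 : 0 ≤ t := (ha.trans ht).le
    have huz : (u : ℂ) ^ (w - 1) ≠ 0 := fun h ↦ hu0 ((Complex.cpow_eq_zero_iff _ _).1 h).1
    rw [hg]; dsimp only
    have e : (Real.cos (2 * π * 1 * (u * t)) : ℂ) * (((u * t : ℝ)) : ℂ) ^ (w - 1) =
        (u : ℂ) ^ (w - 1) * ((Real.cos (2 * π * u * t) : ℂ) * (t : ℂ) ^ (w - 1)) := by
      rw [cpow_mul_ofReal hu.le ht0, mul_one, show 2 * π * (u * t) = 2 * π * u * t by ring]; ring
    rw [e, ← mul_assoc, Complex.cpow_neg, inv_mul_cancel₀ huz, one_mul]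
  rw [h1, integral_comp_mul_left_Ioi g a hu, Complex.real_smul, Complex.ofReal_inv]
  have h2 : (u : ℂ) ^ (-(w - 1)) * (u : ℂ)⁻¹ = (u : ℂ) ^ (-w) := by
    rw [show -(w - 1) = -w + 1 by ring, Complex.cpow_add _ _ hu0, Complex.cpow_one]
    field_simp
  calc 2 * ((u : ℂ) ^ (-(w - 1)) * ((u : ℂ)⁻¹ * ∫ x in Ioi (u * a), g x))
      = 2 * (((u : ℂ) ^ (-(w - 1)) * (u : ℂ)⁻¹) * ∫ x in Ioi (u * a), g x) := by ring
    _ = (u : ℂ) ^ (-w) * (2 * ∫ x in Ioi (u * a), g x) := by rw [h2]; ring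

/-- **Scaling of the kernel, all `w`**: `C_a(u,w) = u^{−w} · C_{ua}(1,w)` for `a, u > 0` and every
`w ∈ ℂ` (analytic continuation from `Re w < 0`). [cite: Burnol2001CRAS, Lemme 1.2 (TeX l.338–355)] -/
theorem cosKernel_scaling {a u : ℝ} (ha : 0 < a) (hu : 0 < u) (w : ℂ) :
    cosKernel a u w = (u : ℂ) ^ (-w) * cosKernel (u * a) 1 w := by
  have hua : 0 < u * a := mul_pos hu ha
  have hu0 : (u : ℂ) ≠ 0 := Complex.ofReal_ne_zero.2 hu.ne'
  have hW : IsOpen {w : ℂ | w.re < 0} := isOpen_lt Complex.continuous_re continuous_const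
  have hev : cosKernel a u =ᶠ[𝓝 (-1 : ℂ)] fun w ↦ (u : ℂ) ^ (-w) * cosKernel (u * a) 1 w := by
    filter_upwards [hW.mem_nhds (by simp : (-1 : ℂ) ∈ {w : ℂ | w.re < 0})] with z hz
    rw [cosKernel_eq_burnolC ha hu.ne' hz, cosKernel_eq_burnolC hua one_ne_zero hz,
      burnolC_scaling ha hu z]
  have h1 : AnalyticOnNhd ℂ (cosKernel a u) univ :=
    (differentiable_cosKernel ha hu.ne').differentiableOn.analyticOnNhd isOpen_univ
  have h2 : AnalyticOnNhd ℂ (fun w ↦ (u : ℂ) ^ (-w) * cosKernel (u * a) 1 w) univ := by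
    refine (Differentiable.differentiableOn ?_).analyticOnNhd isOpen_univ
    exact (differentiable_id.neg.const_cpow (Or.inl hu0)).mul
      (differentiable_cosKernel hua one_ne_zero)
  exact h1.eqOn_of_preconnected_of_eventuallyEq h2 isPreconnected_univ (mem_univ _) hev (mem_univ w)

/-- The finite integral `w ↦ ∫_b^{b'} cos(2πs) s^{w−1} ds` (`0 < b ≤ b'`) is entire. [folklore] -/
private theorem differentiable_setIntegral_cos_mul_cpow {b b' : ℝ} (hb : 0 < b) :
    Differentiable ℂ fun w : ℂ ↦
      ∫ s in Ioc b b', (Real.cos (2 * π * 1 * s) : ℂ) * (s : ℂ) ^ (w - 1) := by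
  set L : ℝ := max |Real.log b| |Real.log b'| with hL
  have hlog : ∀ s ∈ Ioc b b', |Real.log s| ≤ L := by
    intro s hs
    have hs0 : 0 < s := hb.trans hs.1
    rw [abs_le]
    constructor
    · calc -L ≤ -|Real.log b| := neg_le_neg (le_max_left _ _)
        _ ≤ Real.log b := neg_abs_le _
        _ ≤ Real.log s := Real.log_le_log hb hs.1.le
    · calc Real.log s ≤ Real.log b' := Real.log_le_log hs0 hs.2
        _ ≤ |Real.log b'| := le_abs_self _
        _ ≤ L := le_max_right _ _
  refine differentiableOn_univ.1 (Literature.Analysis.Complex.differentiableOn_integral_of_dominated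
    (μ := volume.restrict (Ioc b b')) (U := univ) (fun w _ ↦ ?_) ?_ (fun w₀ _ ↦ ?_))
  · refine ContinuousOn.aestronglyMeasurable (fun s hs ↦ ?_) measurableSet_Ioc
    have hs0 : (s : ℝ) ≠ 0 := (hb.trans hs.1).ne'
    exact ((Complex.continuous_ofReal.comp (Real.continuous_cos.comp (continuous_const.mul
      continuous_id))).continuousAt.mul
      (Complex.continuousAt_ofReal_cpow_const _ _ (Or.inr hs0))).continuousWithinAt
  · filter_upwards [ae_restrict_mem measurableSet_Ioc] with s hs
    have hs0 : (s : ℂ) ≠ 0 := Complex.ofReal_ne_zero.2 (hb.trans hs.1).ne'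
    exact ((differentiable_id.sub_const 1).const_cpow (Or.inl hs0)).const_mul _ |>.differentiableOn
  · refine ⟨1, one_pos, subset_univ _, fun _ ↦ Real.exp ((‖w₀‖ + 2) * L), integrable_const _, ?_⟩
    filter_upwards [ae_restrict_mem measurableSet_Ioc] with s hs w hw
    have hs0 : 0 < s := hb.trans hs.1
    rw [norm_mul, Complex.norm_real, Complex.norm_cpow_eq_rpow_re_of_pos hs0,
      Real.rpow_def_of_pos hs0]
    have hc : ‖Real.cos (2 * π * 1 * s)‖ ≤ 1 := by
      rw [Real.norm_eq_abs]; exact Real.abs_cos_le_one _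
    have hre : |(w - 1).re| ≤ ‖w₀‖ + 2 := by
      have h1 : |(w - 1).re| ≤ ‖w - 1‖ := Complex.abs_re_le_norm _
      have h2 : ‖w - 1‖ ≤ ‖w - w₀‖ + ‖w₀‖ + ‖(1 : ℂ)‖ := by
        calc ‖w - 1‖ = ‖(w - w₀) + w₀ - 1‖ := by ring_nf
          _ ≤ ‖(w - w₀) + w₀‖ + ‖(1 : ℂ)‖ := norm_sub_le _ _
          _ ≤ ‖w - w₀‖ + ‖w₀‖ + ‖(1 : ℂ)‖ := by gcongr; exact norm_add_le _ _
      have h3 : ‖w - w₀‖ < 1 := by rwa [← dist_eq_norm]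
      rw [norm_one] at h2
      linarith
    have hexp : Real.log s * (w - 1).re ≤ (‖w₀‖ + 2) * L := by
      calc Real.log s * (w - 1).re ≤ |Real.log s * (w - 1).re| := le_abs_self _
        _ = |Real.log s| * |(w - 1).re| := abs_mul _ _
        _ ≤ L * (‖w₀‖ + 2) := by gcongr; exacts [hlog s hs]
        _ = (‖w₀‖ + 2) * L := mul_comm _ _
    calc ‖Real.cos (2 * π * 1 * s)‖ * Real.exp (Real.log s * (w - 1).re)
        ≤ 1 * Real.exp ((‖w₀‖ + 2) * L) := by gcongr
      _ = Real.exp ((‖w₀‖ + 2) * L) := one_mul _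

/-- **`C_b(1,w) − C_{b'}(1,w) = 2∫_b^{b'} cos(2πs) s^{w−1} ds`** for `0 < b ≤ b'` and every `w`
(from the integrals for `Re w < 0`, then analytic continuation). With `cosKernel_scaling`:
`C_λ(t,w) = t^{−w}(C_λ(1,w) + 2∫_{λt}^{λ} cos(2πs)s^{w−1}ds)` for `0 < t ≤ 1`.
[cite: Burnol2001CRAS, Lemme 1.2 and eq. (1.3) (TeX l.338–355)] -/
theorem cosKernel_sub_cosKernel {b b' : ℝ} (hb : 0 < b) (hbb' : b ≤ b') (w : ℂ) :
    cosKernel b 1 w - cosKernel b' 1 w =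
      2 * ∫ s in Ioc b b', (Real.cos (2 * π * 1 * s) : ℂ) * (s : ℂ) ^ (w - 1) := by
  have hb' : 0 < b' := hb.trans_le hbb'
  have hW : IsOpen {w : ℂ | w.re < 0} := isOpen_lt Complex.continuous_re continuous_const
  -- `Re w < 0`: split `∫_b^∞ = ∫_b^{b'} + ∫_{b'}^∞`
  have hneg : ∀ z : ℂ, z.re < 0 → cosKernel b 1 z - cosKernel b' 1 z =
      2 * ∫ s in Ioc b b', (Real.cos (2 * π * 1 * s) : ℂ) * (s : ℂ) ^ (z - 1) := by
    intro z hz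
    rw [cosKernel_eq_burnolC hb one_ne_zero hz, cosKernel_eq_burnolC hb' one_ne_zero hz,
      Burnol2001.burnolC, Burnol2001.burnolC, ← mul_sub]
    congr 1
    have hI : IntegrableOn (fun s : ℝ ↦ (Real.cos (2 * π * 1 * s) : ℂ) * (s : ℂ) ^ (z - 1)) (Ioi b) := by
      have hz' : (z - 1).re < -1 := by rw [sub_re, one_re]; linarith
      have h0 := integrableOn_Ioi_cpow_of_lt hz' hb
      refine (h0.norm.mono' ?_ ?_)
      · refine ContinuousOn.aestronglyMeasurable (fun s hs ↦ ?_) measurableSet_Ioi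
        have hs0 : (s : ℝ) ≠ 0 := (hb.trans hs).ne'
        exact ((Complex.continuous_ofReal.comp (Real.continuous_cos.comp (continuous_const.mul
          continuous_id))).continuousAt.mul
          (Complex.continuousAt_ofReal_cpow_const _ _ (Or.inr hs0))).continuousWithinAt
      · filter_upwards [ae_restrict_mem measurableSet_Ioi] with s hs
        rw [norm_mul, Complex.norm_real]
        calc ‖Real.cos (2 * π * 1 * s)‖ * ‖(s : ℂ) ^ (z - 1)‖ ≤ 1 * ‖(s : ℂ) ^ (z - 1)‖ := by
              gcongr; rw [Real.norm_eq_abs]; exact Real.abs_cos_le_one _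
          _ = ‖(s : ℂ) ^ (z - 1)‖ := one_mul _
    rw [← Ioc_union_Ioi_eq_Ioi hbb', setIntegral_union (Set.Ioc_disjoint_Ioi le_rfl)
      measurableSet_Ioi (hI.mono_set Ioc_subset_Ioi_self) (hI.mono_set (Ioi_subset_Ioi hbb')),
      add_sub_cancel_right]
  have hev : (fun z ↦ cosKernel b 1 z - cosKernel b' 1 z) =ᶠ[𝓝 (-1 : ℂ)]
      fun z ↦ 2 * ∫ s in Ioc b b', (Real.cos (2 * π * 1 * s) : ℂ) * (s : ℂ) ^ (z - 1) := by
    filter_upwards [hW.mem_nhds (by simp : (-1 : ℂ) ∈ {w : ℂ | w.re < 0})] with z hz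
    exact hneg z hz
  have h1 : AnalyticOnNhd ℂ (fun z ↦ cosKernel b 1 z - cosKernel b' 1 z) univ :=
    ((differentiable_cosKernel hb one_ne_zero).sub
      (differentiable_cosKernel hb' one_ne_zero)).differentiableOn.analyticOnNhd isOpen_univ
  have h2 : AnalyticOnNhd ℂ (fun z : ℂ ↦ 2 * ∫ s in Ioc b b', (Real.cos (2 * π * 1 * s) : ℂ) *
      (s : ℂ) ^ (z - 1)) univ :=
    ((differentiable_const _).mul (differentiable_setIntegral_cos_mul_cpow hb (b' := b'))).differentiableOn
      |>.analyticOnNhd isOpen_univ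
  exact h1.eqOn_of_preconnected_of_eventuallyEq h2 isPreconnected_univ (mem_univ _) hev (mem_univ w)

end SonineMellin

end Literature.Analysis.DeBrangesSpaces
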